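import Literature.Geometry.Riemannian.MeanConvexRadialHessian
import Literature.Geometry.Riemannian.MeanConvexFrameSum
import Literature.Geometry.Riemannian.MeanConvexTube
import Mathlib.Analysis.InnerProductSpace.Projection.FiniteDimensional
import Mathlib.Analysis.InnerProductSpace.PiL2

/-!
# The graph zones of the bending profile: `Φ(w) = ⟨e, w⟩ - τ(‖P w‖)` and its tangent-frame sum

Topic `Geometry/Riemannian` (fact seat
`provefact-Literature.Geometry.Riemannian.LawsonMichelsohn1984_surrounding`).  Everything here
is **proved**; no definitions.

In the flat model of the junction of Lawson–Michelsohn's surrounding construction (§3), the bent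
hypersurface over the mean-convex `Σ = {⟨e, ·⟩ = 0}` near the attaching sphere is the level set
`{Φ = 0}` of `Φ(w) = ⟨e, w⟩ - τ(‖P w‖)`, where `P` is the orthogonal projection onto the normal
directions `K` of the attaching sphere inside `Σ` (`dim K = k ≥ 2`, `e ⟂ K`) and `τ` the height
profile (`MeanConvexProfile.lean`).  At a point `w` with `y = P w ≠ 0`, `r = ‖y‖`, `ŷ = r⁻¹ y`:

* `hasFDerivAt_graphFun` — `dΦ(w) = ⟨e, ·⟩ - τ'(r) ⟨ŷ, ·⟩`;
* `fderiv_fderiv_graphFun_apply` — `D²Φ(w)(u, u') = -[(τ'' - τ'/r) ⟨ŷ, u⟩⟨ŷ, u'⟩ + (τ'/r) ⟨P u, u'⟩]`;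
* `sum_norm_sq_starProjection` — `∑ⱼ ‖P bⱼ‖² = dim K` for an orthonormal basis `b`;
* `sum_fderiv_fderiv_graphFun`, `fderiv_fderiv_graphFun_grad` — the trace
  `-(τ'' + (k - 1) τ'/r)` and the value `-τ'' τ'²` on the gradient `e - τ' ŷ`;
* `hasFDerivAt_chimneyFun`, `fderiv_fderiv_chimneyFun_apply`, `frameSum_chimneyFun` — the same
  for the chimney `Ψ(w) = ‖P w‖² - ρ(⟨e, w⟩)²` (variable-radius tube around the core):
  frame sum `2 (k - 1) - 2 ρ ρ''/(1 + ρ'²)`;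
* `frameSum_graphFun` — **the tangent-frame sum**
  `∑ᵢ D²Φ(w)(vᵢ, vᵢ) = -τ''/(1 + τ'²) - (k - 1) τ'/r` for every orthonormal frame `v` of
  `ker dΦ(w)`: with `τ' = -tan θ` this is `(θ_r cos θ + (k - 1) sin θ / r)/cos θ`, the flat-model
  mean curvature of `MeanConvexProfile.exists_angleProfile` up to the positive factor `1/cos θ`.

## References

* H. B. Lawson, Jr., M.-L. Michelsohn, *Embedding and surrounding with positive mean curvature*,
  Invent. Math. 77 (1984), §3. [LawsonMichelsohn1984]
-/

noncomputable section

open Set Function Filter Module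
open scoped Topology RealInnerProductSpace

namespace Literature.Geometry.Riemannian

variable {E : Type*} [NormedAddCommGroup E] [InnerProductSpace ℝ E] [FiniteDimensional ℝ E]

/-! ### The defining function of the graph zones and its first two derivatives -/

section Graph

variable (K : Submodule ℝ E) (e : E) (τ : ℝ → ℝ)

/-- `⟨ŷ, P u⟩ = ⟨ŷ, u⟩` for `ŷ ∈ K`. [folklore] -/
theorem inner_starProjection_of_mem {x : E} (hx : x ∈ K) (u : E) :
    ⟪x, K.starProjection u⟫ = ⟪x, u⟫ := by
  rw [← Submodule.inner_starProjection_left_eq_right,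
    (Submodule.starProjection_eq_self_iff).2 hx]

/-- **The differential of `Φ(w) = ⟨e, w⟩ - τ(‖P w‖)`** at a point with `P w ≠ 0`:
`dΦ(w) u = ⟨e, u⟩ - τ'(‖P w‖) ⟨‖P w‖⁻¹ P w, u⟩`. [folklore] -/
theorem hasFDerivAt_graphFun {w : E} (hw : K.starProjection w ≠ 0) {τ' : ℝ}
    (hτ : HasDerivAt τ τ' ‖K.starProjection w‖) :
    HasFDerivAt (fun z : E => ⟪e, z⟫ - τ ‖K.starProjection z‖)
      (innerSL ℝ e - τ' • innerSL ℝ (‖K.starProjection w‖⁻¹ • K.starProjection w)) w := by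
  have h1 : HasFDerivAt (fun z : E => ⟪e, z⟫) (innerSL ℝ e) w := (innerSL ℝ e).hasFDerivAt
  have h2 : HasFDerivAt (fun z : E => τ ‖K.starProjection z‖)
      ((τ' • innerSL ℝ (‖K.starProjection w‖⁻¹ • K.starProjection w)).comp K.starProjection) w :=
    (hasFDerivAt_radial hw hτ).comp w K.starProjection.hasFDerivAt
  have h3 := h1.sub h2
  have hmem : ‖K.starProjection w‖⁻¹ • K.starProjection w ∈ K :=
    K.smul_mem _ (K.starProjection_apply_mem w)
  refine h3.congr_fderiv ?_
  ext u
  simp only [sub_apply, smul_apply, ContinuousLinearMap.comp_apply,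
    innerSL_apply_apply, smul_eq_mul, inner_starProjection_of_mem K hmem]

/-- Near a point `w` with `P w ≠ 0`, `dΦ = ⟨e, ·⟩ - d(τ ∘ ‖·‖)(P ·)`. [folklore] -/
theorem fderiv_graphFun_eventuallyEq {w : E} (hw : K.starProjection w ≠ 0)
    (hτ : ∀ᶠ s in 𝓝 ‖K.starProjection w‖, DifferentiableAt ℝ τ s) :
    (fun z : E => fderiv ℝ (fun z : E => ⟪e, z⟫ - τ ‖K.starProjection z‖) z) =ᶠ[𝓝 w]
      fun z => innerSL ℝ e - fderiv ℝ (fun y : E => τ ‖y‖) (K.starProjection z) := by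
  have hne : ∀ᶠ z in 𝓝 w, K.starProjection z ≠ 0 :=
    (K.starProjection.continuous.continuousAt).eventually (isOpen_ne.eventually_mem hw)
  have hτ' : ∀ᶠ z in 𝓝 w, DifferentiableAt ℝ τ ‖K.starProjection z‖ :=
    (continuous_norm.comp K.starProjection.continuous).continuousAt.eventually hτ
  filter_upwards [hne, hτ'] with z hz hτz
  rw [(hasFDerivAt_graphFun K e τ hz hτz.hasDerivAt).fderiv,
    (hasFDerivAt_radial hz hτz.hasDerivAt).fderiv]

/-- **The Hessian of `Φ(w) = ⟨e, w⟩ - τ(‖P w‖)`** at a point with `y = P w ≠ 0`, `r = ‖y‖`,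
`ŷ = r⁻¹ y`: `D²Φ(w)(u, u') = -[(τ''(r) - τ'(r)/r) ⟨ŷ, u⟩ ⟨ŷ, u'⟩ + (τ'(r)/r) ⟨P u, u'⟩]`.
[folklore] -/
theorem fderiv_fderiv_graphFun_apply {w : E} (hw : K.starProjection w ≠ 0)
    (hτ : ∀ᶠ s in 𝓝 ‖K.starProjection w‖, DifferentiableAt ℝ τ s)
    (hτ' : DifferentiableAt ℝ (deriv τ) ‖K.starProjection w‖) (u u' : E) :
    fderiv ℝ (fun z : E => fderiv ℝ (fun z : E => ⟪e, z⟫ - τ ‖K.starProjection z‖) z) w u u' =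
      -((deriv (deriv τ) ‖K.starProjection w‖ - deriv τ ‖K.starProjection w‖ / ‖K.starProjection w‖) *
          (⟪‖K.starProjection w‖⁻¹ • K.starProjection w, u⟫ *
            ⟪‖K.starProjection w‖⁻¹ • K.starProjection w, u'⟫) +
        deriv τ ‖K.starProjection w‖ / ‖K.starProjection w‖ * ⟪K.starProjection u, u'⟫) := by
  set P := K.starProjection with hP
  set y : E := P w with hy
  -- derivative of `z ↦ innerSL e - fderiv G (P z)` at `w`
  have hG := hasFDerivAt_fderiv_radial (g := τ) hw hτ hτ'
  have hcomp : HasFDerivAt (fun z : E => fderiv ℝ (fun y : E => τ ‖y‖) (P z))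
      ((fderiv ℝ (fun z : E => fderiv ℝ (fun y : E => τ ‖y‖) z) y).comp P) w :=
    hG.differentiableAt.hasFDerivAt.comp w P.hasFDerivAt
  have hsub : HasFDerivAt (fun z : E => innerSL ℝ e - fderiv ℝ (fun y : E => τ ‖y‖) (P z))
      (0 - (fderiv ℝ (fun z : E => fderiv ℝ (fun y : E => τ ‖y‖) z) y).comp P) w :=
    (hasFDerivAt_const _ _).sub hcomp
  have hmain := hsub.congr_of_eventuallyEq (fderiv_graphFun_eventuallyEq K e τ hw hτ)
  rw [hmain.fderiv, zero_sub, neg_apply, neg_apply,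
    ContinuousLinearMap.comp_apply, fderiv_fderiv_radial_apply hw hτ hτ' (P u) u']
  have hmem : ‖y‖⁻¹ • y ∈ K := K.smul_mem _ (K.starProjection_apply_mem w)
  rw [inner_starProjection_of_mem K hmem]

end Graph

/-! ### Traces -/

section Trace

variable (K : Submodule ℝ E)

/-- `⟨P x, x⟩ = ‖P x‖²` for an orthogonal projection. [folklore] -/
theorem inner_starProjection_self_eq_norm_sq (x : E) :
    ⟪K.starProjection x, x⟫ = ‖K.starProjection x‖ ^ 2 := by
  have h : ⟪K.starProjection x, x - K.starProjection x⟫ = 0 := by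
    rw [real_inner_comm]
    exact Submodule.starProjection_inner_eq_zero x _ (K.starProjection_apply_mem x)
  rw [inner_sub_right, sub_eq_zero] at h
  rw [h, real_inner_self_eq_norm_sq]

/-- **`∑ⱼ ‖P bⱼ‖² = dim K`** for an orthogonal projection `P` onto `K` and an orthonormal basis `b`
(the Hilbert–Schmidt norm of a projection is its rank: double Parseval). [folklore] -/
theorem sum_norm_sq_starProjection {ι : Type*} [Fintype ι] (b : OrthonormalBasis ι ℝ E) :
    ∑ j, ‖K.starProjection (b j)‖ ^ 2 = (finrank ℝ K : ℝ) := by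
  classical
  set f := stdOrthonormalBasis ℝ K with hf
  -- `‖P x‖² = ∑ₗ ⟨fₗ, x⟩²`
  have hPx : ∀ x : E, ‖K.starProjection x‖ ^ 2 = ∑ l, ⟪(f l : E), x⟫ ^ 2 := by
    intro x
    have h1 : ‖K.starProjection x‖ = ‖K.orthogonalProjectionOnto x‖ := rfl
    rw [h1, ← f.sum_sq_norm_inner_right (K.orthogonalProjectionOnto x)]
    refine Finset.sum_congr rfl fun l _ => ?_
    rw [Real.norm_eq_abs, sq_abs, Submodule.inner_orthogonalProjectionOnto_eq_of_mem_left]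
  simp_rw [hPx]
  rw [Finset.sum_comm]
  have : ∀ l, ∑ j, ⟪(f l : E), b j⟫ ^ 2 = 1 := fun l => by
    rw [b.sum_sq_inner_left (f l : E)]
    have : ‖(f l : E)‖ = 1 := by rw [Submodule.norm_coe]; exact f.orthonormal.1 l
    rw [this, one_pow]
  simp_rw [this]
  rw [Finset.sum_const, Finset.card_univ, nsmul_eq_mul, mul_one, ← finrank_eq_card_basis f.toBasis]

end Trace

/-! ### The tangent-frame sum of the graph function -/

section FrameSum

variable (K : Submodule ℝ E) {e : E} (τ : ℝ → ℝ) {m : ℕ}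

/-- **The tangent-frame sum of `Φ(w) = ⟨e, w⟩ - τ(‖P w‖)`.**  Let `e` be a unit vector
orthogonal to `K` (`dim E = m + 1`), `w` a point with `y = P w ≠ 0`, `r = ‖y‖`, and `τ` twice
differentiable at `r` (differentiable near `r`).  Then for every orthonormal `m`-frame `v` of
`ker dΦ(w)`:
`∑ᵢ D²Φ(w)(vᵢ, vᵢ) = -τ''(r)/(1 + τ'(r)²) - (dim K - 1) τ'(r)/r`
(trace `-(τ'' + (dim K - 1)τ'/r)` minus the normal value `-τ''τ'²/(1 + τ'²)`).
[cite: LawsonMichelsohn1984, §3] -/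
theorem frameSum_graphFun (hE : finrank ℝ E = m + 1) (he : ‖e‖ = 1) (heK : e ∈ Kᗮ) {w : E}
    (hw : K.starProjection w ≠ 0) (hτ : ∀ᶠ s in 𝓝 ‖K.starProjection w‖, DifferentiableAt ℝ τ s)
    (hτ' : DifferentiableAt ℝ (deriv τ) ‖K.starProjection w‖) {v : Fin m → E}
    (hv : Orthonormal ℝ v)
    (hvf : ∀ i, fderiv ℝ (fun z : E => ⟪e, z⟫ - τ ‖K.starProjection z‖) w (v i) = 0) :
    ∑ i, iteratedFDeriv ℝ 2 (fun z : E => ⟪e, z⟫ - τ ‖K.starProjection z‖) w ![v i, v i] =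
      -(deriv (deriv τ) ‖K.starProjection w‖ / (1 + deriv τ ‖K.starProjection w‖ ^ 2)) -
        ((finrank ℝ K : ℝ) - 1) * deriv τ ‖K.starProjection w‖ / ‖K.starProjection w‖ := by
  set P := K.starProjection with hP
  set y : E := P w with hy
  set r : ℝ := ‖y‖ with hr
  set τ₁ : ℝ := deriv τ r with hτ₁
  set τ₂ : ℝ := deriv (deriv τ) r with hτ₂
  set yh : E := r⁻¹ • y with hyh
  have hrpos : 0 < r := norm_pos_iff.2 hw
  have hyK : y ∈ K := K.starProjection_apply_mem w
  have hyhK : yh ∈ K := K.smul_mem _ hyK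
  have hyh1 : ‖yh‖ = 1 := by
    rw [hyh, norm_smul, norm_inv, Real.norm_eq_abs, abs_of_pos hrpos, inv_mul_cancel₀ hrpos.ne']
  have heyh : ⟪yh, e⟫ = 0 := (Submodule.mem_orthogonal K e).1 heK yh hyhK
  set Φ : E → ℝ := fun z => ⟪e, z⟫ - τ ‖P z‖ with hΦ
  -- the differential and its Riesz vector `g = e - τ₁ yh`
  have hdΦ : fderiv ℝ Φ w = innerSL ℝ e - τ₁ • innerSL ℝ yh :=
    (hasFDerivAt_graphFun K e τ hw (hτ.self_of_nhds.hasDerivAt)).fderiv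
  set g : E := e - τ₁ • yh with hg
  have hgdual : (InnerProductSpace.toDual ℝ E).symm (fderiv ℝ Φ w) = g := by
    apply (InnerProductSpace.toDual ℝ E).injective
    rw [LinearIsometryEquiv.apply_symm_apply, hdΦ]
    ext u
    simp [hg, InnerProductSpace.toDual_apply_apply]
  have hdΦne : fderiv ℝ Φ w ≠ 0 := by
    intro h0
    have : fderiv ℝ Φ w e = 0 := by rw [h0]; rfl
    rw [hdΦ] at this
    simp only [sub_apply, smul_apply, innerSL_apply_apply, smul_eq_mul, real_inner_self_eq_norm_sq,
      he, one_pow, heyh, mul_zero, sub_zero] at this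
    exact one_ne_zero this
  -- the Hessian values
  have hH : ∀ u u' : E, iteratedFDeriv ℝ 2 Φ w ![u, u'] =
      -((τ₂ - τ₁ / r) * (⟪yh, u⟫ * ⟪yh, u'⟫) + τ₁ / r * ⟪P u, u'⟫) := fun u u' => by
    rw [iteratedFDeriv_two_vecCons]
    exact fderiv_fderiv_graphFun_apply K e τ hw hτ hτ' u u'
  -- the general frame-sum identity
  have key := sum_iteratedFDeriv_two_ker_eq hE hdΦne (stdOrthonormalBasis ℝ E) hv hvf
  rw [key, hgdual]
  -- the trace
  set b := stdOrthonormalBasis ℝ E with hb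
  have htr : ∑ j, iteratedFDeriv ℝ 2 Φ w ![b j, b j] = -((τ₂ - τ₁ / r) + τ₁ / r * finrank ℝ K) := by
    simp_rw [hH]
    rw [Finset.sum_neg_distrib, Finset.sum_add_distrib, ← Finset.mul_sum, ← Finset.mul_sum]
    have h1 : ∑ j, ⟪yh, b j⟫ * ⟪yh, b j⟫ = 1 := by
      have := b.sum_sq_inner_left yh
      rw [hyh1, one_pow] at this
      rw [← this]
      exact Finset.sum_congr rfl fun j _ => (sq _).symm
    have h2 : ∑ j, ⟪P (b j), b j⟫ = (finrank ℝ K : ℝ) := by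
      rw [← sum_norm_sq_starProjection K b]
      exact Finset.sum_congr rfl fun j _ => inner_starProjection_self_eq_norm_sq K (b j)
    rw [h1, h2, mul_one]
  -- the normal value
  have hPg : P g = -(τ₁ • yh) := by
    show P (e - τ₁ • yh) = -(τ₁ • yh)
    rw [map_sub, map_smul, (Submodule.starProjection_eq_self_iff).2 hyhK,
      (Submodule.starProjection_apply_eq_zero_iff (K := K)).2 heK, zero_sub]
  have hyg : ⟪yh, g⟫ = -τ₁ := by
    show ⟪yh, e - τ₁ • yh⟫ = -τ₁
    rw [inner_sub_right, heyh, real_inner_smul_right, real_inner_self_eq_norm_sq, hyh1, one_pow,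
      mul_one, zero_sub]
  have hgg : iteratedFDeriv ℝ 2 Φ w ![g, g] = -(τ₂ * τ₁ ^ 2) := by
    rw [hH, hPg, inner_neg_left, hyg, real_inner_smul_left, hyg]
    ring
  have hng : ‖g‖ ^ 2 = 1 + τ₁ ^ 2 := by
    show ‖e - τ₁ • yh‖ ^ 2 = 1 + τ₁ ^ 2
    rw [@norm_sub_sq_real, he, norm_smul, hyh1, mul_one, Real.norm_eq_abs, sq_abs,
      real_inner_smul_right, real_inner_comm, heyh, mul_zero, mul_zero, sub_zero, one_pow]
  rw [htr, hgg, hng]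
  have h1 : (1 : ℝ) + τ₁ ^ 2 ≠ 0 := by positivity
  field_simp
  ring

end FrameSum

/-! ### The chimney: `Ψ(w) = ‖P w‖² - ρ(⟨e, w⟩)²` -/

section Chimney

variable (K : Submodule ℝ E) (e : E) (ρ : ℝ → ℝ) {m : ℕ}

/-- **The differential of `Ψ(w) = ‖P w‖² - ρ(⟨e, w⟩)²`**:
`dΨ(w) u = 2 ⟨P w, u⟩ - 2 ρ ρ' ⟨e, u⟩`. [folklore] -/
theorem hasFDerivAt_chimneyFun {w : E} {ρ' : ℝ} (hρ : HasDerivAt ρ ρ' ⟪e, w⟫) :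
    HasFDerivAt (fun z : E => ‖K.starProjection z‖ ^ 2 - ρ ⟪e, z⟫ ^ 2)
      ((2 : ℝ) • innerSL ℝ (K.starProjection w) - (2 * ρ ⟪e, w⟫ * ρ') • innerSL ℝ e) w := by
  have h1 : HasFDerivAt (fun z : E => ‖K.starProjection z‖ ^ 2)
      ((2 : ℝ) • (innerSL ℝ (K.starProjection w)).comp K.starProjection) w := by
    have h := (hasStrictFDerivAt_norm_sq (K.starProjection w)).hasFDerivAt.comp w
      K.starProjection.hasFDerivAt
    refine h.congr_fderiv ?_
    ext u
    simp only [ContinuousLinearMap.comp_apply, smul_apply, innerSL_apply_apply,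
      nsmul_eq_mul, Nat.cast_ofNat, smul_eq_mul]
  have h2 : HasFDerivAt (fun z : E => ρ ⟪e, z⟫ ^ 2) ((2 * ρ ⟪e, w⟫ * ρ') • innerSL ℝ e) w := by
    have ha : HasFDerivAt (fun z : E => ρ ⟪e, z⟫) (ρ' • innerSL ℝ e) w :=
      hρ.comp_hasFDerivAt w (innerSL ℝ e).hasFDerivAt
    have hb : HasFDerivAt (fun z : E => ρ ⟪e, z⟫ * ρ ⟪e, z⟫)
        (ρ ⟪e, w⟫ • (ρ' • innerSL ℝ e) + ρ ⟪e, w⟫ • (ρ' • innerSL ℝ e)) w := ha.mul ha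
    have heq : (fun z : E => ρ ⟪e, z⟫ ^ 2) = fun z => ρ ⟪e, z⟫ * ρ ⟪e, z⟫ := funext fun z => sq _
    rw [heq]
    refine hb.congr_fderiv ?_
    rw [smul_smul, ← add_smul]
    congr 1
    ring
  have h3 := h1.sub h2
  refine h3.congr_fderiv ?_
  ext u
  simp only [sub_apply, smul_apply, ContinuousLinearMap.comp_apply, innerSL_apply_apply,
    smul_eq_mul, inner_starProjection_of_mem K (K.starProjection_apply_mem w)]

/-- **The Hessian of `Ψ`**: `D²Ψ(w)(u, u') = 2 ⟨P u, u'⟩ - 2 (ρ'² + ρ ρ'') ⟨e, u⟩ ⟨e, u'⟩`.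
[folklore] -/
theorem fderiv_fderiv_chimneyFun_apply {w : E}
    (hρ : ∀ᶠ s in 𝓝 ⟪e, w⟫, DifferentiableAt ℝ ρ s) (hρ' : DifferentiableAt ℝ (deriv ρ) ⟪e, w⟫)
    (u u' : E) :
    fderiv ℝ (fun z : E => fderiv ℝ (fun z : E => ‖K.starProjection z‖ ^ 2 - ρ ⟪e, z⟫ ^ 2) z) w u u' =
      2 * ⟪K.starProjection u, u'⟫ -
        2 * (deriv ρ ⟪e, w⟫ ^ 2 + ρ ⟪e, w⟫ * deriv (deriv ρ) ⟪e, w⟫) * (⟪e, u⟫ * ⟪e, u'⟫) := by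
  set P := K.starProjection with hP
  -- `dΨ` near `w`
  have hev : (fun z : E => fderiv ℝ (fun z : E => ‖P z‖ ^ 2 - ρ ⟪e, z⟫ ^ 2) z) =ᶠ[𝓝 w]
      fun z => (2 : ℝ) • innerSL ℝ (P z) - (2 * ρ ⟪e, z⟫ * deriv ρ ⟪e, z⟫) • innerSL ℝ e := by
    have hρz : ∀ᶠ z in 𝓝 w, DifferentiableAt ℝ ρ ⟪e, z⟫ :=
      (innerSL ℝ e).continuous.continuousAt.eventually hρ
    filter_upwards [hρz] with z hz
    exact (hasFDerivAt_chimneyFun K e ρ hz.hasDerivAt).fderiv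
  -- differentiate the right-hand side at `w`
  have hc : HasFDerivAt (fun z : E => 2 * ρ ⟪e, z⟫ * deriv ρ ⟪e, z⟫)
      ((2 * ρ ⟪e, w⟫) • (deriv (deriv ρ) ⟪e, w⟫ • innerSL ℝ e) +
        deriv ρ ⟪e, w⟫ • ((2 : ℝ) • (deriv ρ ⟪e, w⟫ • innerSL ℝ e))) w := by
    have ha : HasFDerivAt (fun z : E => ρ ⟪e, z⟫) (deriv ρ ⟪e, w⟫ • innerSL ℝ e) w :=
      hρ.self_of_nhds.hasDerivAt.comp_hasFDerivAt w (innerSL ℝ e).hasFDerivAt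
    have hb : HasFDerivAt (fun z : E => deriv ρ ⟪e, z⟫) (deriv (deriv ρ) ⟪e, w⟫ • innerSL ℝ e) w :=
      hρ'.hasDerivAt.comp_hasFDerivAt w (innerSL ℝ e).hasFDerivAt
    exact (ha.const_mul 2).mul hb
  have hL : HasFDerivAt
      (fun z : E => (2 : ℝ) • innerSL ℝ (P z) - (2 * ρ ⟪e, z⟫ * deriv ρ ⟪e, z⟫) • innerSL ℝ e)
      ((2 : ℝ) • ((innerSL ℝ (E := E)).comp P) -
        ((2 * ρ ⟪e, w⟫) • (deriv (deriv ρ) ⟪e, w⟫ • innerSL ℝ e) +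
          deriv ρ ⟪e, w⟫ • ((2 : ℝ) • (deriv ρ ⟪e, w⟫ • innerSL ℝ e))).smulRight (innerSL ℝ e)) w := by
    have h0 : HasFDerivAt (fun z : E => innerSL ℝ (P z)) ((innerSL ℝ (E := E)).comp P) w :=
      ((innerSL ℝ (E := E)).hasFDerivAt).comp w P.hasFDerivAt
    have h1 : HasFDerivAt (fun z : E => (2 : ℝ) • innerSL ℝ (P z))
        ((2 : ℝ) • ((innerSL ℝ (E := E)).comp P)) w := h0.const_smul (2 : ℝ)
    exact h1.sub (hc.smul_const (innerSL ℝ e))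
  have hmain := hL.congr_of_eventuallyEq hev
  rw [hmain.fderiv]
  have key : ∀ a c : E, (innerSL ℝ (E := E)) a c = ⟪a, c⟫ := fun a c => rfl
  simp only [sub_apply, add_apply, smul_apply, ContinuousLinearMap.comp_apply,
    ContinuousLinearMap.smulRight_apply, key, smul_eq_mul]
  ring

/-- **The tangent-frame sum of the chimney function** `Ψ(w) = ‖P w‖² - ρ(⟨e, w⟩)²` at a point of
the chimney `‖P w‖ = ρ(t) > 0`, `t = ⟨e, w⟩` (`e` unit, `e ⟂ K`, `dim E = m + 1`):
`∑ᵢ D²Ψ(w)(vᵢ, vᵢ) = 2 (dim K - 1) - 2 ρ ρ'' / (1 + ρ'²)` for every orthonormal `m`-frame of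
`ker dΨ(w)` — i.e. `‖∇Ψ‖` times the flat-model mean curvature
`(k - 1)/(ρ √(1 + ρ'²)) - ρ''/(1 + ρ'²)^{3/2}` of the variable-radius tube `{‖y‖ = ρ(t)}`.
[cite: LawsonMichelsohn1984, §3] -/
theorem frameSum_chimneyFun (hE : finrank ℝ E = m + 1) (he : ‖e‖ = 1) (heK : e ∈ Kᗮ) {w : E}
    (hρ : ∀ᶠ s in 𝓝 ⟪e, w⟫, DifferentiableAt ℝ ρ s) (hρ' : DifferentiableAt ℝ (deriv ρ) ⟪e, w⟫)
    (hpos : 0 < ρ ⟪e, w⟫) (hw : ‖K.starProjection w‖ = ρ ⟪e, w⟫) {v : Fin m → E}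
    (hv : Orthonormal ℝ v)
    (hvf : ∀ i, fderiv ℝ (fun z : E => ‖K.starProjection z‖ ^ 2 - ρ ⟪e, z⟫ ^ 2) w (v i) = 0) :
    ∑ i, iteratedFDeriv ℝ 2 (fun z : E => ‖K.starProjection z‖ ^ 2 - ρ ⟪e, z⟫ ^ 2) w ![v i, v i] =
      2 * ((finrank ℝ K : ℝ) - 1) -
        2 * ρ ⟪e, w⟫ * deriv (deriv ρ) ⟪e, w⟫ / (1 + deriv ρ ⟪e, w⟫ ^ 2) := by
  set P := K.starProjection with hP
  set y : E := P w with hy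
  set t : ℝ := ⟪e, w⟫ with ht
  set ρ₀ : ℝ := ρ t with hρ₀
  set ρ₁ : ℝ := deriv ρ t with hρ₁
  set ρ₂ : ℝ := deriv (deriv ρ) t with hρ₂
  have hyK : y ∈ K := K.starProjection_apply_mem w
  have hey : ⟪e, y⟫ = 0 := by rw [real_inner_comm]; exact (Submodule.mem_orthogonal K e).1 heK y hyK
  set Ψ : E → ℝ := fun z => ‖P z‖ ^ 2 - ρ ⟪e, z⟫ ^ 2 with hΨ
  -- differential and gradient `g = 2 (y - ρ₀ ρ₁ e)`
  have hdΨ : fderiv ℝ Ψ w = (2 : ℝ) • innerSL ℝ y - (2 * ρ₀ * ρ₁) • innerSL ℝ e :=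
    (hasFDerivAt_chimneyFun K e ρ hρ.self_of_nhds.hasDerivAt).fderiv
  set g : E := (2 : ℝ) • y - (2 * ρ₀ * ρ₁) • e with hg
  have hgdual : (InnerProductSpace.toDual ℝ E).symm (fderiv ℝ Ψ w) = g := by
    apply (InnerProductSpace.toDual ℝ E).injective
    rw [LinearIsometryEquiv.apply_symm_apply, hdΨ]
    ext u
    simp [hg, InnerProductSpace.toDual_apply_apply]
  have hny : ‖y‖ = ρ₀ := hw
  have hdΨne : fderiv ℝ Ψ w ≠ 0 := by
    intro h0
    have : fderiv ℝ Ψ w y = 0 := by rw [h0]; rfl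
    rw [hdΨ] at this
    simp only [sub_apply, smul_apply, innerSL_apply_apply, smul_eq_mul, real_inner_self_eq_norm_sq,
      hny, hey, mul_zero, sub_zero] at this
    have : ρ₀ ^ 2 = 0 := by nlinarith
    exact absurd (pow_eq_zero_iff (n := 2) (by norm_num) |>.1 this) hpos.ne'
  -- Hessian values
  have hH : ∀ u u' : E, iteratedFDeriv ℝ 2 Ψ w ![u, u'] =
      2 * ⟪P u, u'⟫ - 2 * (ρ₁ ^ 2 + ρ₀ * ρ₂) * (⟪e, u⟫ * ⟪e, u'⟫) := fun u u' => by
    rw [iteratedFDeriv_two_vecCons]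
    exact fderiv_fderiv_chimneyFun_apply K e ρ hρ hρ' u u'
  have key := sum_iteratedFDeriv_two_ker_eq hE hdΨne (stdOrthonormalBasis ℝ E) hv hvf
  rw [key, hgdual]
  set b := stdOrthonormalBasis ℝ E with hb
  -- trace
  have htr : ∑ j, iteratedFDeriv ℝ 2 Ψ w ![b j, b j] =
      2 * (finrank ℝ K : ℝ) - 2 * (ρ₁ ^ 2 + ρ₀ * ρ₂) := by
    simp_rw [hH]
    rw [Finset.sum_sub_distrib, ← Finset.mul_sum, ← Finset.mul_sum]
    have h1 : ∑ j, ⟪P (b j), b j⟫ = (finrank ℝ K : ℝ) := by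
      rw [← sum_norm_sq_starProjection K b]
      exact Finset.sum_congr rfl fun j _ => inner_starProjection_self_eq_norm_sq K (b j)
    have h2 : ∑ j, ⟪e, b j⟫ * ⟪e, b j⟫ = 1 := by
      have := b.sum_sq_inner_left e
      rw [he, one_pow] at this
      rw [← this]
      exact Finset.sum_congr rfl fun j _ => (sq _).symm
    rw [h1, h2, mul_one]
  -- normal value
  have hPg : P g = (2 : ℝ) • y := by
    show P ((2 : ℝ) • y - (2 * ρ₀ * ρ₁) • e) = (2 : ℝ) • y
    rw [map_sub, map_smul, map_smul, (Submodule.starProjection_eq_self_iff).2 hyK,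
      (Submodule.starProjection_apply_eq_zero_iff (K := K)).2 heK, smul_zero, sub_zero]
  have heg : ⟪e, g⟫ = -(2 * ρ₀ * ρ₁) := by
    show ⟪e, (2 : ℝ) • y - (2 * ρ₀ * ρ₁) • e⟫ = _
    rw [inner_sub_right, real_inner_smul_right, real_inner_smul_right, hey, real_inner_self_eq_norm_sq,
      he]
    ring
  have hyg : ⟪y, g⟫ = 2 * ρ₀ ^ 2 := by
    show ⟪y, (2 : ℝ) • y - (2 * ρ₀ * ρ₁) • e⟫ = _
    rw [inner_sub_right, real_inner_smul_right, real_inner_smul_right, real_inner_self_eq_norm_sq,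
      hny, real_inner_comm, hey]
    ring
  have hgg : iteratedFDeriv ℝ 2 Ψ w ![g, g] = 8 * ρ₀ ^ 2 - 8 * ρ₀ ^ 2 * ρ₁ ^ 2 * (ρ₁ ^ 2 + ρ₀ * ρ₂) := by
    rw [hH, hPg, real_inner_smul_left, hyg, heg]
    ring
  have hng : ‖g‖ ^ 2 = 4 * ρ₀ ^ 2 * (1 + ρ₁ ^ 2) := by
    have : ‖g‖ ^ 2 = ⟪g, g⟫ := (real_inner_self_eq_norm_sq g).symm
    rw [this]
    show ⟪(2 : ℝ) • y - (2 * ρ₀ * ρ₁) • e, g⟫ = _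
    rw [inner_sub_left, real_inner_smul_left, real_inner_smul_left, hyg, heg]
    ring
  rw [htr, hgg, hng]
  have h1 : (1 : ℝ) + ρ₁ ^ 2 ≠ 0 := by positivity
  have h2 : ρ₀ ≠ 0 := hpos.ne'
  field_simp
  ring

end Chimney

end Literature.Geometry.Riemannian

end
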